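import Summits.KontsevichZagierPeriods.KontsevichZagierPeriods.Theorems.LogPrimitiveNL.Negative.LoadBearing

/-!
# Crux `LiouvilleUnfolding.LogPrimitiveNL` (stmt-KontsevichZagierPeriods-2836), line `logderiv-peeling`:
# load-bearing hypotheses of `stub_constRigidity` (drefute, gen 2 — file 1/3)

Negative-side support for the lead of line `logderiv-peeling`
(`Cruxes/LogPrimitiveNL/Lines/logderiv-peeling.lean`, skeleton sha `c0b749c6…`, 7 stubs). The stub
`stub_constRigidity` (Baker at rational points + density) is restated VERBATIM as the `Prop`
`ConstRigidity`, and for each hypothesis `H` that a cheap model shows to be load-bearing we record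
`¬ (stub without H)` by an explicit datum over the one-point base `ℝ⁰` ("any proof of the stub must use
`H`"; the lead may not weaken these hypotheses when reshaping):

* `not_constRigidityWithoutIsAlgebraic` — `c = 1/log 2`, `W = 2`, `G = 1`.
* `not_constRigidityWithoutSemialgebraicG` — `c = 1`, `W = 2`, `G = log 2`.
* `not_constRigidityWithoutSemialgebraicW` — `c = 1`, `W = e`, `G = 1`.
* `not_constRigidityWithoutPos` — `c = 1`, `W = 0`, `G = 0` (junk `Real.log 0 = 0`; the lattice
  clause fails: `0 ^ f = 1` forces `f = 0`).

Not load-bearing / redundant (paper; drefute notes on the item): `IsSemialgebraic ℚ D` (projection of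
the graph of `G`), `ContinuousOn G D` (`G = Σ cᵢ log Wᵢ` is continuous), and the pair `IsOpen D` +
`ContinuousOn (W i) D` (replaceable by an algebraic point of a non-empty `ℚ`-semialgebraic set, item
4090 — keeping them is cheaper). §0 is a small toolkit for data over `ℝ⁰` (Dirac volume) shared by
files 2/3 (`StubDescent`) and 3/3 (`StubCalculus`).
-/

noncomputable section

open Set MeasureTheory
open Literature.NumberTheory.Transcendental Literature.ModelTheory.ExponentialFields

namespace Summit.KontsevichZagierPeriods.LiouvilleUnfolding.LogPrimitiveNL.Negative

/-! ## §0 One-point base toolkit -/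

/-- The point of `ℝ⁰`. -/
def pt0 : Fin 0 → ℝ := fun i => i.elim0

/-- On `ℝ⁰`, Lebesgue measure is the Dirac mass: a set whose complement is null contains the point. -/
theorem mem_of_volume_univ_diff_eq_zero {S : Set (Fin 0 → ℝ)}
    (h : volume ((univ : Set (Fin 0 → ℝ)) \ S) = 0) (x : Fin 0 → ℝ) : x ∈ S := by
  by_contra hx
  have hS : (univ : Set (Fin 0 → ℝ)) \ S = univ := by
    ext y
    simp only [mem_sdiff, mem_univ, true_and, iff_true]
    rwa [Subsingleton.elim y x]
  rw [hS, volume_pi, Measure.pi_of_empty (fun _ => (volume : Measure ℝ)) x,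
    Measure.dirac_apply_of_mem (mem_univ _)] at h
  exact one_ne_zero h

/-- The constant `2` is a `ℚ`-semialgebraic function. -/
theorem isSemialgebraicFunOn_two {m : ℕ} {s : Set (Fin m → ℝ)} (hs : IsSemialgebraic ℚ s) :
    IsSemialgebraicFunOn ℚ s (fun _ => (2 : ℝ)) := by
  simpa using isSemialgebraicFunOn_const hs 2

/-- The constant `1` is a `ℚ`-semialgebraic function. -/
theorem isSemialgebraicFunOn_one {m : ℕ} {s : Set (Fin m → ℝ)} (hs : IsSemialgebraic ℚ s) :
    IsSemialgebraicFunOn ℚ s (fun _ => (1 : ℝ)) := by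
  simpa using isSemialgebraicFunOn_const hs 1

/-- The constant `0` is a `ℚ`-semialgebraic function. -/
theorem isSemialgebraicFunOn_zero {m : ℕ} {s : Set (Fin m → ℝ)} (hs : IsSemialgebraic ℚ s) :
    IsSemialgebraicFunOn ℚ s (fun _ => (0 : ℝ)) := by
  simpa using isSemialgebraicFunOn_const hs 0

/-- `log 2 ≠ 0`. -/
theorem log_two_ne_zero' : Real.log 2 ≠ 0 := (Real.log_pos one_lt_two).ne'

/-! ## §1 `stub_constRigidity` -/

/-- `stub_constRigidity` of the skeleton, verbatim. -/
def ConstRigidity : Prop :=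
  ∀ (n k : ℕ) (D : Set (Fin n → ℝ)) (c : Fin k → ℝ) (W : Fin k → (Fin n → ℝ) → ℝ)
    (G : (Fin n → ℝ) → ℝ), IsSemialgebraic ℚ D → IsOpen D → (∀ i, IsAlgebraic ℚ (c i)) →
    (∀ i, IsSemialgebraicFunOn ℚ D (W i)) → (∀ i, ContinuousOn (W i) D) →
    (∀ i, ∀ x ∈ D, 0 < W i x) → IsSemialgebraicFunOn ℚ D G → ContinuousOn G D →
    (∀ x ∈ D, ∑ i, c i * Real.log (W i x) = G x) →
    (∀ x ∈ D, G x = 0) ∧ ∃ (R : ℕ) (f : Fin R → Fin k → ℤ) (β : Fin R → ℝ),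
      (∀ r, IsAlgebraic ℚ (β r)) ∧ (∀ r, ∀ x ∈ D, ∏ i, W i x ^ (f r i) = 1) ∧
      (∀ i, c i = ∑ r, β r * (f r i : ℝ))

/-- `stub_constRigidity` with the algebraicity of the coefficients `cᵢ` dropped. -/
def ConstRigidityWithoutIsAlgebraic : Prop :=
  ∀ (n k : ℕ) (D : Set (Fin n → ℝ)) (c : Fin k → ℝ) (W : Fin k → (Fin n → ℝ) → ℝ)
    (G : (Fin n → ℝ) → ℝ), IsSemialgebraic ℚ D → IsOpen D →
    (∀ i, IsSemialgebraicFunOn ℚ D (W i)) → (∀ i, ContinuousOn (W i) D) →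
    (∀ i, ∀ x ∈ D, 0 < W i x) → IsSemialgebraicFunOn ℚ D G → ContinuousOn G D →
    (∀ x ∈ D, ∑ i, c i * Real.log (W i x) = G x) →
    (∀ x ∈ D, G x = 0) ∧ ∃ (R : ℕ) (f : Fin R → Fin k → ℤ) (β : Fin R → ℝ),
      (∀ r, IsAlgebraic ℚ (β r)) ∧ (∀ r, ∀ x ∈ D, ∏ i, W i x ^ (f r i) = 1) ∧
      (∀ i, c i = ∑ r, β r * (f r i : ℝ))

/-- **Algebraicity of `c` is load-bearing**: `n = 0`, `k = 1`, `c = 1/log 2` (transcendental),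
`W = 2`, `G = 1`: all remaining hypotheses hold and `G ≠ 0`. -/
theorem not_constRigidityWithoutIsAlgebraic : ¬ ConstRigidityWithoutIsAlgebraic := by
  intro H
  have hu : IsSemialgebraic ℚ (univ : Set (Fin 0 → ℝ)) := isSemialgebraic_univ
  have h := (H 0 1 univ (fun _ => (Real.log 2)⁻¹) (fun _ _ => 2) (fun _ => 1) hu isOpen_univ
    (fun _ => isSemialgebraicFunOn_two hu) (fun _ => continuousOn_const) (fun _ _ _ => two_pos)
    (isSemialgebraicFunOn_one hu) continuousOn_const
    (fun x _ => by rw [Fin.sum_univ_one, inv_mul_cancel₀ log_two_ne_zero'])).1 pt0 (mem_univ _)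
  exact one_ne_zero h

/-- `stub_constRigidity` with the `ℚ`-semialgebraicity of `G` dropped. -/
def ConstRigidityWithoutSemialgebraicG : Prop :=
  ∀ (n k : ℕ) (D : Set (Fin n → ℝ)) (c : Fin k → ℝ) (W : Fin k → (Fin n → ℝ) → ℝ)
    (G : (Fin n → ℝ) → ℝ), IsSemialgebraic ℚ D → IsOpen D → (∀ i, IsAlgebraic ℚ (c i)) →
    (∀ i, IsSemialgebraicFunOn ℚ D (W i)) → (∀ i, ContinuousOn (W i) D) →
    (∀ i, ∀ x ∈ D, 0 < W i x) → ContinuousOn G D →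
    (∀ x ∈ D, ∑ i, c i * Real.log (W i x) = G x) →
    (∀ x ∈ D, G x = 0) ∧ ∃ (R : ℕ) (f : Fin R → Fin k → ℤ) (β : Fin R → ℝ),
      (∀ r, IsAlgebraic ℚ (β r)) ∧ (∀ r, ∀ x ∈ D, ∏ i, W i x ^ (f r i) = 1) ∧
      (∀ i, c i = ∑ r, β r * (f r i : ℝ))

/-- **`ℚ`-semialgebraicity of `G` is load-bearing**: `c = 1`, `W = 2`, `G = log 2 ≠ 0`. -/
theorem not_constRigidityWithoutSemialgebraicG : ¬ ConstRigidityWithoutSemialgebraicG := by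
  intro H
  have hu : IsSemialgebraic ℚ (univ : Set (Fin 0 → ℝ)) := isSemialgebraic_univ
  have h := (H 0 1 univ (fun _ => 1) (fun _ _ => 2) (fun _ => Real.log 2) hu isOpen_univ
    (fun _ => isAlgebraic_one) (fun _ => isSemialgebraicFunOn_two hu) (fun _ => continuousOn_const)
    (fun _ _ _ => two_pos) continuousOn_const
    (fun x _ => by rw [Fin.sum_univ_one, one_mul])).1 pt0 (mem_univ _)
  exact log_two_ne_zero' h

/-- `stub_constRigidity` with the `ℚ`-semialgebraicity of the `Wᵢ` dropped. -/
def ConstRigidityWithoutSemialgebraicW : Prop :=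
  ∀ (n k : ℕ) (D : Set (Fin n → ℝ)) (c : Fin k → ℝ) (W : Fin k → (Fin n → ℝ) → ℝ)
    (G : (Fin n → ℝ) → ℝ), IsSemialgebraic ℚ D → IsOpen D → (∀ i, IsAlgebraic ℚ (c i)) →
    (∀ i, ContinuousOn (W i) D) →
    (∀ i, ∀ x ∈ D, 0 < W i x) → IsSemialgebraicFunOn ℚ D G → ContinuousOn G D →
    (∀ x ∈ D, ∑ i, c i * Real.log (W i x) = G x) →
    (∀ x ∈ D, G x = 0) ∧ ∃ (R : ℕ) (f : Fin R → Fin k → ℤ) (β : Fin R → ℝ),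
      (∀ r, IsAlgebraic ℚ (β r)) ∧ (∀ r, ∀ x ∈ D, ∏ i, W i x ^ (f r i) = 1) ∧
      (∀ i, c i = ∑ r, β r * (f r i : ℝ))

/-- **`ℚ`-semialgebraicity of `W` is load-bearing**: `c = 1`, `W = e` (the transcendental
constant function is not `ℚ`-semialgebraic), `G = 1 ≠ 0`. -/
theorem not_constRigidityWithoutSemialgebraicW : ¬ ConstRigidityWithoutSemialgebraicW := by
  intro H
  have hu : IsSemialgebraic ℚ (univ : Set (Fin 0 → ℝ)) := isSemialgebraic_univ
  have h := (H 0 1 univ (fun _ => 1) (fun _ _ => Real.exp 1) (fun _ => 1) hu isOpen_univ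
    (fun _ => isAlgebraic_one) (fun _ => continuousOn_const)
    (fun _ _ _ => Real.exp_pos 1) (isSemialgebraicFunOn_one hu) continuousOn_const
    (fun x _ => by rw [Fin.sum_univ_one, one_mul, Real.log_exp])).1 pt0 (mem_univ _)
  exact one_ne_zero h

/-- `stub_constRigidity` with the positivity of the `Wᵢ` dropped. -/
def ConstRigidityWithoutPos : Prop :=
  ∀ (n k : ℕ) (D : Set (Fin n → ℝ)) (c : Fin k → ℝ) (W : Fin k → (Fin n → ℝ) → ℝ)
    (G : (Fin n → ℝ) → ℝ), IsSemialgebraic ℚ D → IsOpen D → (∀ i, IsAlgebraic ℚ (c i)) →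
    (∀ i, IsSemialgebraicFunOn ℚ D (W i)) → (∀ i, ContinuousOn (W i) D) →
    IsSemialgebraicFunOn ℚ D G → ContinuousOn G D →
    (∀ x ∈ D, ∑ i, c i * Real.log (W i x) = G x) →
    (∀ x ∈ D, G x = 0) ∧ ∃ (R : ℕ) (f : Fin R → Fin k → ℤ) (β : Fin R → ℝ),
      (∀ r, IsAlgebraic ℚ (β r)) ∧ (∀ r, ∀ x ∈ D, ∏ i, W i x ^ (f r i) = 1) ∧
      (∀ i, c i = ∑ r, β r * (f r i : ℝ))

/-- **Positivity of `W` is load-bearing** (through the junk value `Real.log 0 = 0`): `c = 1`,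
`W = 0`, `G = 0`; the identity `1 · log 0 = 0` holds, `G ≡ 0` holds, but every exact relation
`0 ^ f ≡ 1` has `f = 0`, so `c = Σ β_r f_r = 0 ≠ 1`. -/
theorem not_constRigidityWithoutPos : ¬ ConstRigidityWithoutPos := by
  intro H
  have hu : IsSemialgebraic ℚ (univ : Set (Fin 0 → ℝ)) := isSemialgebraic_univ
  obtain ⟨-, R, f, β, -, hf, hc⟩ := H 0 1 univ (fun _ => 1) (fun _ _ => 0) (fun _ => 0) hu
    isOpen_univ (fun _ => isAlgebraic_one) (fun _ => isSemialgebraicFunOn_zero hu)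
    (fun _ => continuousOn_const) (isSemialgebraicFunOn_zero hu) continuousOn_const
    (fun x _ => by rw [Fin.sum_univ_one, Real.log_zero, mul_zero])
  have hf0 : ∀ r, f r 0 = 0 := fun r => by
    by_contra hr
    have := hf r pt0 (mem_univ _)
    rw [Fin.prod_univ_one, zero_zpow _ hr] at this
    exact zero_ne_one this
  have := hc 0
  simp only [hf0, Int.cast_zero, mul_zero, Finset.sum_const_zero] at this
  exact one_ne_zero this

end Summit.KontsevichZagierPeriods.LiouvilleUnfolding.LogPrimitiveNL.Negative

end
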